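import Summits.HodgeConjecture.HodgeCM.PerL34.ArchAFock_1

/-! PORT of `HodgeCM/PerL34/ArchAFock.lean` (HodgeCMPerL run 82) — part 2: continuation of `Summits.HodgeConjecture.HodgeCM.PerL34.ArchAFock_1` (split at a top-level declaration boundary by port_pkg.py; scope re-opened below; declarations unchanged). -/

-- port_pkg: scope re-opened for this part (file-level context, then the namespace/section stack open at the cut)
set_option autoImplicit false
noncomputable section
open Function MvPolynomial
open scoped TensorProduct BigOperators
namespace HodgeCM
namespace PerL34
namespace Fock
namespace LocalWeil

/-- KERNEL constructor: any polynomial Fock model `ℂ[X_σ]` with scaling weights `s` and vacuum twist `k₀`. -/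
def ofPoly (σ : Type) [Fintype σ] (s : σ → ℤ) (k₀ : ℤ) : LocalWeil where
  M := MvPolynomial σ ℂ
  ρ := circleScale s k₀
  dec := iSup_weightSpace_circleScale_eq_top s k₀

/-- KERNEL constructor, the slot of `ι₁`: pv12's `ℂ[z₁,z₂,w]` with `harmCircle k₀`. -/
def harm (k₀ : ℤ) : LocalWeil where
  M := HarmModel
  ρ := harmCircle k₀
  dec := iSup_weightSpace_harmCircle_eq_top k₀

/-- KERNEL constructor, the slot of a real place `b ≠ ι₁`: `ℂ[z₁,z₂,z₃]` with `defCircle k₀`. -/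
def «def» (k₀ : ℤ) : LocalWeil where
  M := DefModel
  ρ := defCircle k₀
  dec := iSup_weightSpace_defCircle_eq_top k₀

/-- KERNEL constructor, an inert slot (the finite-adelic factor `𝒮(V(𝔸_f))`, on which `U(W_{i,b})`, `b` real, does
not act): trivial action, everything of weight `0`. -/
def inert (N : Type) [AddCommGroup N] [Module ℂ N] : LocalWeil where
  M := N
  ρ := 1
  dec := by
    rw [eq_top_iff, ← weightSpace_one_zero]
    exact le_iSup (fun k : ℤ => weightSpace (1 : Circle →* Module.End ℂ N) k) 0

/-- (Ported verbatim from the HodgeCMPerL package; no docstring in the source.) -/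
theorem harm_M (k₀ : ℤ) : (harm k₀).M = HarmModel := rfl

/-- (Ported verbatim from the HodgeCMPerL package; no docstring in the source.) -/
theorem harm_ρ (k₀ : ℤ) : (harm k₀).ρ = harmCircle k₀ := rfl

/-- (Ported verbatim from the HodgeCMPerL package; no docstring in the source.) -/
theorem def_M (k₀ : ℤ) : («def» k₀).M = DefModel := rfl

/-- (Ported verbatim from the HodgeCMPerL package; no docstring in the source.) -/
theorem def_ρ (k₀ : ℤ) : («def» k₀).ρ = defCircle k₀ := rfl

end LocalWeil

end Fock

/-! ## §3  The bridge: `LineArchData` over the tensor product of the slots, with the two PRINT inputs PROVED -/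

namespace ArchA

open MeasureTheory Fock

/-- **`LineArchData` over the factorised `𝒮`.**  The posited one-line data of PerL v5 §4.1 / Lemma 4.1(a) exactly as in
`ArchA.LineArchData` (same labels), except that the free data `S`, `ωb`, `piece` are REPLACED by the finite family of
tensor slots of `𝒮((V₃ ⊗ W_i)(𝔸)) = (⊗_{b real} 𝒮_b) ⊗ 𝒮(V(𝔸_f))` (tex l. 262, §4.1 ll. 472–476): `S := ⨂[ℂ] i,
(loc i).M`, `U(W_{i,b})` acting on the slot of `b`, the weight spaces DEFINED as the `u^k`-eigenspaces. -/
structure FockLineArchBridge where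
  /-- the real places `b` of `L₀`. -/
  RealPl : Type
  /-- the distinguished real place `ι₁`. -/
  ι₁ : RealPl
  /-- `[U(W_i)] = U(W_i)(L₀)\U(W_i)(𝔸)`, a compact group (tex l. 266). -/
  Q : Type
  [iQ₁ : Group Q]
  [iQ₂ : TopologicalSpace Q]
  [iQ₃ : IsTopologicalGroup Q]
  [iQ₄ : CompactSpace Q]
  [iQ₅ : MeasurableSpace Q]
  [iQ₆ : BorelSpace Q]
  /-- the Haar probability measure `du` on `[U(W_i)]`. -/
  μ : Measure Q
  [iμ₁ : IsProbabilityMeasure μ]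
  [iμ₂ : μ.IsMulRightInvariant]
  /-- the image of `U(W_{i,b}) = U(1)` (real place `b`) in `[U(W_i)]`. -/
  toQ : RealPl → (Circle →* Q)
  /-- automorphic forms on `[G_U]` (only the Banach-space structure is used). -/
  A : Type
  [iA₁ : NormedAddCommGroup A]
  [iA₂ : NormedSpace ℂ A]
  [iA₃ : CompleteSpace A]
  /-- [NEW, replaces `S`] the tensor slots of `𝒮((V₃ ⊗ W_i)(𝔸))`: the real places and the finite-adelic factor. -/
  Slot : Type
  [iSl₁ : Fintype Slot]
  [iSl₂ : DecidableEq Slot]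
  /-- [NEW] the local factor in each slot with its `U(1)`-action (INTENDED: `LocalWeil.harm k₀` in the slot of `ι₁`,
  `LocalWeil.def k₀'` in the slot of `b ≠ ι₁`, `LocalWeil.inert 𝒮(V(𝔸_f))` in the finite slot). -/
  loc : Slot → LocalWeil
  /-- [NEW] the slot of the real place `b` (tex l. 476: `ω|_{U(W_{i,b})}` acts on the `b`-th factor). -/
  slotOf : RealPl → Slot
  /-- the theta kernel restricted to `[U(W_i)]`: `φ ↦ (u ↦ θ_φ(·,u))` (tex ll. 262–265), on the factorised `𝒮`. -/
  Θ : (⨂[ℂ] i : Slot, (loc i).M) →ₗ[ℂ] (Q → A)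
  /-- the weight of the summand carrying `J⁺` (`b = ι₁`) resp. `𝟏_{U(3)}` (`b ≠ ι₁`) — [BW] VIII 2.8/2.14. -/
  kJ : RealPl → ℤ
  /-- automorphic characters `χ'` of `[U(W_i)]` (continuous unitary characters). -/
  X : Type
  /-- `χ'` as a character of `[U(W_i)]`. -/
  χQ : X → (Q →* Circle)

attribute [instance] FockLineArchBridge.iQ₁ FockLineArchBridge.iQ₂ FockLineArchBridge.iQ₃ FockLineArchBridge.iQ₄
  FockLineArchBridge.iQ₅ FockLineArchBridge.iQ₆ FockLineArchBridge.iμ₁ FockLineArchBridge.iμ₂ FockLineArchBridge.iA₁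
  FockLineArchBridge.iA₂ FockLineArchBridge.iA₃ FockLineArchBridge.iSl₁ FockLineArchBridge.iSl₂

namespace FockLineArchBridge

variable (B : FockLineArchBridge)

/-- `𝒮 := ⨂_i 𝒮_i` over the slots. -/
abbrev S : Type := ⨂[ℂ] i : B.Slot, (B.loc i).M

/-- `ω|_{U(W_{i,b})}`: the slot-`b` circle acting in its slot, identity elsewhere. -/
def ωb (b : B.RealPl) : Circle →* Module.End ℂ B.S :=
  slotAct (M := fun i => (B.loc i).M) (B.slotOf b) (B.loc (B.slotOf b)).ρ

/-- the weight spaces `𝒮[b,k]` := the `u ↦ u^k` eigenspaces of `U(W_{i,b})` ([BW] VIII 2.7, a DEFINITION). -/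
def piece (b : B.RealPl) (k : ℤ) : Submodule ℂ B.S := weightSpace (B.ωb b) k

/-- (Ported verbatim from the HodgeCMPerL package; no docstring in the source.) -/
theorem ωb_apply (b : B.RealPl) (u : Circle) :
    B.ωb b u = slot (M := fun i => (B.loc i).M) (B.slotOf b) ((B.loc (B.slotOf b)).ρ u) := rfl

/-- (Ported verbatim from the HodgeCMPerL package; no docstring in the source.) -/
theorem mem_piece_iff (b : B.RealPl) (k : ℤ) (φ : B.S) : φ ∈ B.piece b k ↔ ∀ u : Circle, B.ωb b u φ = ((u : ℂ) ^ k) • φ :=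
  mem_weightSpace_iff _ _ _

/-- **The `LineArchData` of the bridge**: every ArchA field verbatim, `S`/`ωb`/`piece` the factorised ones. -/
def toLineArchData : LineArchData where
  RealPl := B.RealPl
  ι₁ := B.ι₁
  Q := B.Q
  μ := B.μ
  toQ := B.toQ
  A := B.A
  S := B.S
  ωb := B.ωb
  Θ := B.Θ
  piece := B.piece
  kJ := B.kJ
  X := B.X
  χQ := B.χQ

/-- (Ported verbatim from the HodgeCMPerL package; no docstring in the source.) -/
theorem toLineArchData_S : B.toLineArchData.S = B.S := rfl

/-- (Ported verbatim from the HodgeCMPerL package; no docstring in the source.) -/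
theorem toLineArchData_piece : B.toLineArchData.piece = B.piece := rfl

/-- (Ported verbatim from the HodgeCMPerL package; no docstring in the source.) -/
theorem toLineArchData_ωb : B.toLineArchData.ωb = B.ωb := rfl

/-- **`WeightAction` PROVED** (definitional: the pieces are the `u^k`-eigenspaces). -/
theorem weightAction : B.toLineArchData.WeightAction := fun b k u φ hφ => (B.mem_piece_iff b k φ).mp hφ u

/-- **`WeightDecomposition` PROVED**: `𝒮` is the sum of its `U(W_{i,b})`-weight spaces, for every real place `b`
(§1 transport of the slot's `dec` — KERNEL for the explicit local Fock models, §2). -/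
theorem iSup_piece_eq_top (b : B.RealPl) : ⨆ k : ℤ, B.piece b k = ⊤ :=
  iSup_weightSpace_slotAct_eq_top (M := fun i => (B.loc i).M) (B.slotOf b) (B.loc (B.slotOf b)).ρ
    (B.loc (B.slotOf b)).dec

/-- (Ported verbatim from the HodgeCMPerL package; no docstring in the source.) -/
theorem weightDecomposition : B.toLineArchData.WeightDecomposition := fun b => by
  show ⨆ k : ℤ, B.piece b k = ⊤
  exact B.iSup_piece_eq_top b

/-- **N27 = PerL v5 Lemma 4.1(a) over the factorised `𝒮` — pv02's `N27_of` with the two PRINT inputs DISCHARGED**: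
only the DEFINITIONAL theta-kernel input `ThetaKernel` (tex ll. 262–266) is left. -/
theorem N27_of_fock (hT : B.toLineArchData.ThetaKernel) : B.toLineArchData.N27_statement :=
  LineArchData.N27_of hT B.weightAction B.weightDecomposition

/-- The N27 → N31f edge (`ArchA.LineArchData.isotypic_of_locMatches`) with `WeightAction` discharged. -/
theorem isotypic_of_locMatches_fock (χ : B.toLineArchData.X) (hχ : B.toLineArchData.LocMatches χ)
    (b : B.toLineArchData.RealPl) {φ : B.toLineArchData.S} (hφ : φ ∈ B.toLineArchData.piece b (B.toLineArchData.kJ b))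
    (u : Circle) :
    B.toLineArchData.ωb b u φ = (starRingEnd ℂ) ((B.toLineArchData.loc χ b u : ℂ)) • φ :=
  LineArchData.isotypic_of_locMatches B.weightAction χ hχ b hφ u

/-- A pure tensor with a weight-`k` vector of the slot-`b` circle in the slot of `b` lies in `𝒮[b,k]`; in the INTENDED
instance at `ι₁` (`loc (slotOf ι₁) = LocalWeil.harm k₀`) pv05/pv12's `F_k` consists of weight-`(k + k₀)` vectors
(`Fock.wpiece_le_weightSpace uWt k₀ k`, `Fock.weightSpace_harmCircle_eq`) — e.g. pv14-g3's `J⁺`-piece `F_1` has weight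
`1 + k₀`, which is what the datum `kJ ι₁` then names. -/
theorem tprod_update_mem_piece (b : B.RealPl) (m : Π i : B.Slot, (B.loc i).M) {k : ℤ} {x : (B.loc (B.slotOf b)).M}
    (hx : x ∈ weightSpace (B.loc (B.slotOf b)).ρ k) :
    PiTensorProduct.tprod ℂ (update m (B.slotOf b) x) ∈ B.piece b k :=
  tprod_update_mem_weightSpace (M := fun i => (B.loc i).M) (B.slotOf b) (B.loc (B.slotOf b)).ρ m hx

end FockLineArchBridge

end ArchA

end PerL34
end HodgeCM

end

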